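import Summits.HodgeConjecture.HodgeConjecture.Theorems.VHCAbelianSchemesRoadDiagonalPrime
import HarnessLib

/-!
# Road b02 (`VHCAbelianSchemesRoad`, D-0059) — THE ADDITIVE (SPAN) FORM OF REGIME 2 over the UNCHANGED door:
# finitely many admissible data per pencil, `a•W + Z` in the span of the carried classes (predicates + per-pencil lemma)

research route conditional on HC_CM; not a corollary; Q11.4-sentence-2 already refuted in dim ≥ 3.
(cell line of seat ab-andre-2: research route, not a corollary; conditional on HC_CM plus one named minimal statement.)

THEOREMS + two `@[conjecture]` predicates (graded, binders VERBATIM those of `LefAtExceptionalRegimeAt` /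
`AdmissibleRepresentativesLefAtDeg`, `VHCAbelianSchemesRoadRegimeDefs.lean`); no named fact, no sorry; `HC_CM` occurs nowhere;
nothing of the road's research content (an admissible carrier on some fibre) is claimed. Seat ab-andre-2 gen 66 (K-ADD of
director-hodge R11.3, 2026-08-27; readings: LEAD 160 `DQ112-QALPHA-READING-g160.md` §3, ab-andre-2 `ADDITIVE-DOOR-g66.md` §4 —
evidence #49 / #51 on item stmt-HodgeConjecture-20707). The route file, its `closes` glue of record, the binders of record
(items 20707 / 20706) and the registered skeleton are NOT touched: helper `--supports stmt-HodgeConjecture-20707`.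

WHY. The `closes` kernel consumes the door `LocalVariationalHodgeFor 𝒪` ONCE per pencil, on the ONE datum regime 2 delivers
(`not_countable_algebraicityLocus_of_datum`, `VHCAbelianSchemesRoadDiagonal.lean` l.109, the call at l.134), and reads the datum only
through its classes. Additivity therefore belongs to the CONCLUSION of the crux, not to the door: if finitely many `𝒪`-data on one
pencil — each at its own fibre `s i`, with its own index set `I i ∋ p`, classes `κ i` and global fibrewise-Hodge extensions `V i`
(exactly what regime 2 delivers per datum) — carry classes `V i p` whose span contains `a•W + Z` (`a ≠ 0`, `Z` fibrewise
algebraic-Lefschetz), then the door applied PER DATUM (l.109 verbatim with `W := V i p`, `a := 1`, `Z := 0`) makes the algebraicity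
locus of each `V i p` uncountable, the curve residual (`Ring2.Binders.curve_not_subset_iUnion_of_not_countable` +
`Theorems.mem_algebraicClasses_of_thickSet charlesSchnell_algebraicityLocus_iUnion_closed_holds`, both PROVED, no fact binder) makes
each `V i p` algebraic on EVERY fibre, and `Submodule.sum_mem` makes `W` algebraic on every fibre. The object-level alternative
(«direct sums of admissible objects» as a new admissibility notion, same kernel) was REJECTED by R11.3: it moves the price into the
door binder (ab-andre-2 g66 certificate: at the `(4,2)` split anchor `E₀⁴`, `E₀ = ℂ/ℤ[i]`, an honest rank-22 direct sum of line bundles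
has `ch₁ = 0`, `ch₂ = θ² − 4w₁`, so a door for sums would assert the Weil class `w₁` algebraic with no semiregular object).

WHAT THIS FILE PROVES.
* §1 `LefAtExceptionalRegimeAtAdd 𝒪 n p` (regime 2, additive: `0 < k` data), `AdmissibleRepresentativesLefAtDegAdd 𝒪 n p` (the graded
  crux, additive: `k = 0` allowed — the Lefschetz case is DATUM-FREE, `Z := −W`), single ⟹ additive (`k = 1`; so the additive
  predicates are WEAKER than `LefAtExceptionalRegimeAt` / `AdmissibleRepresentativesLefAtDeg`), monotonicity in the door.
* §2 per pencil: the additive graded crux at `(n, p)` + the door ⟹ `W` is algebraic on EVERY fibre (hence its locus is uncountable).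
* §3 `admissibleRepresentativesLefAtDegAdd_of_regimeAdd`: regime 2 (additive) ALONE gives the additive graded crux — regime 1 needs
  no null datum, so no inclusion hypothesis `bfSingleAdmissible(') ≤ Adm` appears anywhere below.
* The engine twins (node (U), row b02, `HC_AV` from the DIAGONAL of the additive graded crux) and the `closes`-shape kernel heads
  (`hc_av_of_exceptionalRegimeAtAdd_twisted_diagonal_two`, `hc_av_of_exceptionalRegimeAtAdd_admTw'_diagonal_two`, the `(6,3)`-on twins)
  are in the companion file `VHCAbelianSchemesRoadRegimeAdditiveKernel.lean` (≤ 400 lines per file).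

NOT claimed: any cell of either regime; that two carried directions exist anywhere; anything about `HC_CM`.
References: [BuchweitzFlenner2003] §5 Thm. 5.1; [Bloch1972Semiregularity] Rem. (7.5); [vanGeemen1994HodgeAV] §2.4, Thm. 4.11;
[CharlesSchnell2014Notes] Conj. 11.3.1, Prop. 11.3.11, Cor. 11.3.6; [BrosnanFangNiePearlstein2009] §6 Lemma 48; [Lieberman1968];
[Markman2025SurveySecant] Cor. 1.3; [Markman2025SecantWeil] Thm. 1.4.1, Thm. 1.5.1; [Andre1996Motifs] §6.3; [GortzWedhorn2023]
Thm. 27.291; [Pridham2024Semiregularity] Cor. 2.25, Rem. 2.26; [VoisinHodgeII2003] §3.3.1, §7.3.2.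
-/

noncomputable section

open CategoryTheory CategoryTheory.Limits AlgebraicGeometry Topology MonoidalCategory CartesianMonoidalCategory

namespace Summit.HodgeConjecture.HodgeConjecture.Ring2.SemiregularRepresentatives

set_option linter.dupNamespace false -- the cell's namespace repeats the summit name, as in every `Ring2*` file

open Literature.AlgebraicGeometry Literature.AlgebraicGeometry.Motives Literature.AlgebraicGeometry.HodgeTheory
open Literature.AlgebraicTopology.SingularHomology
open Literature.AlgebraicGeometry.Andre1996 (andre1996_cmAnchoredPencil
  andre1996_cmHodgeClasses_algebraicallyAnchoredPencils)
open Literature.Barriers.HodgeConjecture (divisorClassesSpan)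
open Summit.Ventures.HSemireg (ObjClass LocalVariationalHodgeFor)
open Summit.HodgeConjecture.HodgeConjecture.Ring2.Hypotheses (AbelianSchemeVHC)
open Summit.HodgeConjecture.HodgeConjecture.Ring2.Binders
open Summit.HodgeConjecture.HodgeConjecture.Ring2.ClassTargets

/-! ## §1 The additive (span) predicates -/

/-- **Regime 2 of K-SR♭∃ for the door `𝒪` at `(n, p)`, ADDITIVE (SPAN) FORM** (`LefAtExceptionalRegimeAtAdd 𝒪 n p`): the binders of
`LefAtExceptionalRegimeAt 𝒪 n p` VERBATIM (one-parameter abelian scheme of relative dimension `n` over a smooth irreducible affine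
curve with a section and quasi-projective total space; a fibrewise rational `(p,p)` global class `W`, algebraic at `s₀`, NOT
algebraic-Lefschetz on every fibre); conclusion: FINITELY MANY (`k`, `0 < k`) `𝒪`-admissible data on the pencil — the `i`-th at
its own fibre `s i`, with its own index set `I i ∋ p`, classes `κ i` on `X_{s i}` and global classes `V i q` restricting to
`κ i q` at `s i` and of type `(q,q)` on every fibre (`q ∈ I i`) — a scalar `a ≠ 0` and a fibrewise algebraic-Lefschetz global `Z`
with `a•W + Z = ∑ i, c i • V i p`: «`W` lies, modulo Lefschetz classes, in the SPAN of the classes carried by admissible objects at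
fibres of the pencil». `k = 1`, `c = 1` is `LefAtExceptionalRegimeAt` (`lefAtExceptionalRegimeAtAdd_of_lefAtExceptionalRegimeAt`).
OPEN in the middle range; a HYPOTHESIS wherever used. [cite: vanGeemen1994HodgeAV, §2.4 and Thm. 4.11]
[cite: BuchweitzFlenner2003, §5 Thm. 5.1] [cite: Markman2025SecantWeil, Thm. 1.4.1 and Thm. 1.5.1] -/
@[conjecture] def LefAtExceptionalRegimeAtAdd (𝒪 : ObjClass) (n p : ℕ) : Prop :=
  ∀ ⦃𝒳 S : SchemeOver ℂ⦄ (f : 𝒳 ⟶ S), IsSmoothProjectiveFamily f n → IsQuasiProjectiveOver 𝒳 →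
    IrreducibleSpace S.left → IsAffine S.left → AlgebraicGeometry.Smooth S.hom → topologicalKrullDim S.left = 1 →
    (∀ s : ComplexPoints S, ∃ A' : AbelianVariety ℂ, A'.dim = n ∧ Nonempty (A'.X ≅ fiberOver f s)) →
    (∃ e : S ⟶ 𝒳, e ≫ f = 𝟙 S) →
    ∀ (W : complexBetti 𝒳 (2 * p)),
      (∀ s : ComplexPoints S, IsRationalClass (complexBetti.map (fiberι f s) (2 * p) W) ∧
        IsOfHodgeType n (fiberOver f s) (2 * p) p p (complexBetti.map (fiberι f s) (2 * p) W)) →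
      ∀ s₀ : ComplexPoints S,
        complexBetti.map (fiberι f s₀) (2 * p) W ∈ algebraicClasses (fiberOver f s₀) p →
        (¬ ∀ s : ComplexPoints S,
          complexBetti.map (fiberι f s) (2 * p) W ∈ algebraicClasses (fiberOver f s) p ∧
          complexBetti.map (fiberι f s) (2 * p) W ∈ divisorClassesSpan (fiberOver f s) n p) →
        ∃ (k : ℕ) (s : Fin k → ComplexPoints S) (I : Fin k → Finset ℕ)
          (κ : (i : Fin k) → (q : ℕ) → complexBetti (fiberOver f (s i)) (2 * q))
          (V : Fin k → (q : ℕ) → complexBetti 𝒳 (2 * q)) (c : Fin k → ℂ) (a : ℂ) (Z : complexBetti 𝒳 (2 * p)),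
          0 < k ∧
          (∀ i, p ∈ I i ∧ 𝒪 n (fiberOver f (s i)) (I i) (κ i) ∧
            (∀ q ∈ I i, κ i q = complexBetti.map (fiberι f (s i)) (2 * q) (V i q)) ∧
            (∀ q ∈ I i, ∀ t : ComplexPoints S,
              IsOfHodgeType n (fiberOver f t) (2 * q) q q (complexBetti.map (fiberι f t) (2 * q) (V i q)))) ∧
          a ≠ 0 ∧
          (∀ t : ComplexPoints S,
            complexBetti.map (fiberι f t) (2 * p) Z ∈ algebraicClasses (fiberOver f t) p ∧
            complexBetti.map (fiberι f t) (2 * p) Z ∈ divisorClassesSpan (fiberOver f t) n p) ∧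
          a • W + Z = ∑ i, c i • V i p

/-- **K-SR♭∃ for the door `𝒪` at `(n, p)`, ADDITIVE (SPAN) FORM** (`AdmissibleRepresentativesLefAtDegAdd 𝒪 n p`): the binders of
`AdmissibleRepresentativesLefAtDeg 𝒪 n p` VERBATIM; conclusion as in `LefAtExceptionalRegimeAtAdd` but with `k = 0` ALLOWED — the
empty family: then `a•W + Z = 0`, i.e. `W` is fibrewise algebraic-Lefschetz (regime 1, DATUM-FREE). [cite: vanGeemen1994HodgeAV, §2.4]
[cite: Bloch1972Semiregularity, Remark (7.5)] [cite: BuchweitzFlenner2003, §5 Thm. 5.1] -/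
@[conjecture] def AdmissibleRepresentativesLefAtDegAdd (𝒪 : ObjClass) (n p : ℕ) : Prop :=
  ∀ ⦃𝒳 S : SchemeOver ℂ⦄ (f : 𝒳 ⟶ S), IsSmoothProjectiveFamily f n → IsQuasiProjectiveOver 𝒳 →
    IrreducibleSpace S.left → IsAffine S.left → AlgebraicGeometry.Smooth S.hom → topologicalKrullDim S.left = 1 →
    (∀ s : ComplexPoints S, ∃ A' : AbelianVariety ℂ, A'.dim = n ∧ Nonempty (A'.X ≅ fiberOver f s)) →
    (∃ e : S ⟶ 𝒳, e ≫ f = 𝟙 S) →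
    ∀ (W : complexBetti 𝒳 (2 * p)),
      (∀ s : ComplexPoints S, IsRationalClass (complexBetti.map (fiberι f s) (2 * p) W) ∧
        IsOfHodgeType n (fiberOver f s) (2 * p) p p (complexBetti.map (fiberι f s) (2 * p) W)) →
      ∀ s₀ : ComplexPoints S,
        complexBetti.map (fiberι f s₀) (2 * p) W ∈ algebraicClasses (fiberOver f s₀) p →
        ∃ (k : ℕ) (s : Fin k → ComplexPoints S) (I : Fin k → Finset ℕ)
          (κ : (i : Fin k) → (q : ℕ) → complexBetti (fiberOver f (s i)) (2 * q))
          (V : Fin k → (q : ℕ) → complexBetti 𝒳 (2 * q)) (c : Fin k → ℂ) (a : ℂ) (Z : complexBetti 𝒳 (2 * p)),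
          (∀ i, p ∈ I i ∧ 𝒪 n (fiberOver f (s i)) (I i) (κ i) ∧
            (∀ q ∈ I i, κ i q = complexBetti.map (fiberι f (s i)) (2 * q) (V i q)) ∧
            (∀ q ∈ I i, ∀ t : ComplexPoints S,
              IsOfHodgeType n (fiberOver f t) (2 * q) q q (complexBetti.map (fiberι f t) (2 * q) (V i q)))) ∧
          a ≠ 0 ∧
          (∀ t : ComplexPoints S,
            complexBetti.map (fiberι f t) (2 * p) Z ∈ algebraicClasses (fiberOver f t) p ∧
            complexBetti.map (fiberι f t) (2 * p) Z ∈ divisorClassesSpan (fiberOver f t) n p) ∧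
          a • W + Z = ∑ i, c i • V i p

variable {𝒪 𝒪' : ObjClass} {n p : ℕ}

/-- **Single ⟹ additive (regime 2)**: one datum is a one-member family (`k = 1`, `c = 1`). So `LefAtExceptionalRegimeAtAdd` is
WEAKER than `LefAtExceptionalRegimeAt` — the slice of item 20707 implies its additive twin. [folklore] -/
theorem lefAtExceptionalRegimeAtAdd_of_lefAtExceptionalRegimeAt (h : LefAtExceptionalRegimeAt 𝒪 n p) :
    LefAtExceptionalRegimeAtAdd 𝒪 n p := by
  intro 𝒳 S f hf h𝒳 hirr haff hsm hdim habel he W hW s₀ hs₀ hexc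
  obtain ⟨s₁, I, κ, V, a, Z, hpI, hκ, ha, hZ, hVp, hκV, hVH⟩ := h f hf h𝒳 hirr haff hsm hdim habel he W hW s₀ hs₀ hexc
  refine ⟨1, fun _ => s₁, fun _ => I, fun _ => κ, fun _ => V, fun _ => 1, a, Z, Nat.one_pos,
    fun _ => ⟨hpI, hκ, hκV, hVH⟩, ha, hZ, ?_⟩
  simp only [Fin.sum_univ_one, one_smul]
  exact hVp.symm

/-- **Single ⟹ additive (the graded crux)**. [folklore] -/
theorem admissibleRepresentativesLefAtDegAdd_of_admissibleRepresentativesLefAtDeg (h : AdmissibleRepresentativesLefAtDeg 𝒪 n p) :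
    AdmissibleRepresentativesLefAtDegAdd 𝒪 n p := by
  intro 𝒳 S f hf h𝒳 hirr haff hsm hdim habel he W hW s₀ hs₀
  obtain ⟨s₁, I, κ, V, a, Z, hpI, hκ, ha, hZ, hVp, hκV, hVH⟩ := h f hf h𝒳 hirr haff hsm hdim habel he W hW s₀ hs₀
  refine ⟨1, fun _ => s₁, fun _ => I, fun _ => κ, fun _ => V, fun _ => 1, a, Z,
    fun _ => ⟨hpI, hκ, hκV, hVH⟩, ha, hZ, ?_⟩
  simp only [Fin.sum_univ_one, one_smul]
  exact hVp.symm

/-- Regime 2 (additive) at `(n, p)` is monotone in the door. [folklore] -/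
theorem LefAtExceptionalRegimeAtAdd.mono (h𝒪 : ∀ n X₀ I κ, 𝒪 n X₀ I κ → 𝒪' n X₀ I κ)
    (h : LefAtExceptionalRegimeAtAdd 𝒪 n p) : LefAtExceptionalRegimeAtAdd 𝒪' n p := by
  intro 𝒳 S f hf h𝒳 hirr haff hsm hdim habel he W hW s₀ hs₀ hexc
  obtain ⟨k, s, I, κ, V, c, a, Z, hk, hdat, ha, hZ, hsum⟩ := h f hf h𝒳 hirr haff hsm hdim habel he W hW s₀ hs₀ hexc
  exact ⟨k, s, I, κ, V, c, a, Z, hk,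
    fun i => ⟨(hdat i).1, h𝒪 _ _ _ _ (hdat i).2.1, (hdat i).2.2.1, (hdat i).2.2.2⟩, ha, hZ, hsum⟩

/-- The additive graded crux at `(n, p)` is monotone in the door. [folklore] -/
theorem AdmissibleRepresentativesLefAtDegAdd.mono (h𝒪 : ∀ n X₀ I κ, 𝒪 n X₀ I κ → 𝒪' n X₀ I κ)
    (h : AdmissibleRepresentativesLefAtDegAdd 𝒪 n p) : AdmissibleRepresentativesLefAtDegAdd 𝒪' n p := by
  intro 𝒳 S f hf h𝒳 hirr haff hsm hdim habel he W hW s₀ hs₀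
  obtain ⟨k, s, I, κ, V, c, a, Z, hdat, ha, hZ, hsum⟩ := h f hf h𝒳 hirr haff hsm hdim habel he W hW s₀ hs₀
  exact ⟨k, s, I, κ, V, c, a, Z,
    fun i => ⟨(hdat i).1, h𝒪 _ _ _ _ (hdat i).2.1, (hdat i).2.2.1, (hdat i).2.2.2⟩, ha, hZ, hsum⟩

/-- The additive graded crux at `(n, p)` gives regime 2 (additive) at `(n, p)` (drop the regime hypothesis; `0 < k` because
`k = 0` would make `W` fibrewise algebraic-Lefschetz). [folklore] -/
theorem lefAtExceptionalRegimeAtAdd_of_admissibleRepresentativesLefAtDegAdd (h : AdmissibleRepresentativesLefAtDegAdd 𝒪 n p) :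
    LefAtExceptionalRegimeAtAdd 𝒪 n p := by
  intro 𝒳 S f hf h𝒳 hirr haff hsm hdim habel he W hW s₀ hs₀ hexc
  obtain ⟨k, s, I, κ, V, c, a, Z, hdat, ha, hZ, hsum⟩ := h f hf h𝒳 hirr haff hsm hdim habel he W hW s₀ hs₀
  refine ⟨k, s, I, κ, V, c, a, Z, ?_, hdat, ha, hZ, hsum⟩
  rcases Nat.eq_zero_or_pos k with hk | hk
  · subst hk
    refine (hexc fun t => ?_).elim
    have hW0 : complexBetti.map (fiberι f t) (2 * p) W = -(a⁻¹ • complexBetti.map (fiberι f t) (2 * p) Z) := by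
      have h0 : a • W + Z = 0 := by rw [hsum, Fin.sum_univ_zero]
      have h1 : a • W = -Z := (neg_eq_of_add_eq_zero_left h0).symm
      have hW : W = -(a⁻¹ • Z) := by
        calc W = a⁻¹ • (a • W) := by rw [smul_smul, inv_mul_cancel₀ ha, one_smul]
          _ = -(a⁻¹ • Z) := by rw [h1, smul_neg]
      rw [hW, map_neg, map_smul]
    rw [hW0]
    exact ⟨Submodule.neg_mem _ (Submodule.smul_mem _ _ (hZ t).1), Submodule.neg_mem _ (Submodule.smul_mem _ _ (hZ t).2)⟩
  · exact hk

/-! ## §2 Per pencil: the additive graded crux at `(n, p)` + the door ⟹ `W` is algebraic on EVERY fibre -/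

variable {𝒳 S : SchemeOver ℂ}

/-- **Per pencil, the additive graded crux + the door ⟹ `W` is algebraic on EVERY fibre.** For each datum `i` the door gives, by
`not_countable_algebraicityLocus_of_datum` VERBATIM (with `W := V i p`, `a := 1`, `Z := 0`), an uncountable algebraicity locus for
`V i p`; on a smooth irreducible affine curve an uncountable set is thick (`curve_not_subset_iUnion_of_not_countable`) and the
algebraicity locus is a countable union of Zariski-closed sets (`charlesSchnell_algebraicityLocus_iUnion_closed_holds`), so `V i p`
is algebraic on every fibre (`Theorems.mem_algebraicClasses_of_thickSet`); then `W = a⁻¹(∑ i, c i • V i p − Z)` is.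
[cite: BuchweitzFlenner2003, §5 Thm. 5.1 (argument shape)] [cite: CharlesSchnell2014Notes, Prop. 11.3.11 (proof)]
[cite: VoisinHodgeII2003, §3.3.1 and §7.3.2] -/
theorem map_fiberι_mem_algebraicClasses_of_lefAtDegAdd (hT : LocalVariationalHodgeFor 𝒪)
    (hSR : AdmissibleRepresentativesLefAtDegAdd 𝒪 n p) (f : 𝒳 ⟶ S) (hf : IsSmoothProjectiveFamily f n)
    (h𝒳 : IsQuasiProjectiveOver 𝒳) [IrreducibleSpace S.left] [IsAffine S.left] [AlgebraicGeometry.Smooth S.hom]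
    (hdim : topologicalKrullDim S.left = 1)
    (habel : ∀ s : ComplexPoints S, ∃ A' : AbelianVariety ℂ, A'.dim = n ∧ Nonempty (A'.X ≅ fiberOver f s))
    (he : ∃ e : S ⟶ 𝒳, e ≫ f = 𝟙 S) (W : complexBetti 𝒳 (2 * p))
    (hW : ∀ s : ComplexPoints S, IsRationalClass (complexBetti.map (fiberι f s) (2 * p) W) ∧
      IsOfHodgeType n (fiberOver f s) (2 * p) p p (complexBetti.map (fiberι f s) (2 * p) W))
    {s₀ : ComplexPoints S} (hs₀ : complexBetti.map (fiberι f s₀) (2 * p) W ∈ algebraicClasses (fiberOver f s₀) p)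
    (t : ComplexPoints S) :
    complexBetti.map (fiberι f t) (2 * p) W ∈ algebraicClasses (fiberOver f t) p := by
  obtain ⟨k, s, I, κ, V, c, a, Z, hdat, ha, hZ, hsum⟩ := hSR f hf h𝒳 ‹_› ‹_› ‹_› hdim habel he W hW s₀ hs₀
  -- each carried class `V i p` is algebraic on every fibre
  have hV : ∀ (i : Fin k) (u : ComplexPoints S),
      complexBetti.map (fiberι f u) (2 * p) (V i p) ∈ algebraicClasses (fiberOver f u) p := by
    intro i
    obtain ⟨hpI, hκ, hκV, hVH⟩ := hdat i
    have hnc : ¬ {u : ComplexPoints S | complexBetti.map (fiberι f u) (2 * p) (V i p) ∈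
        algebraicClasses (fiberOver f u) p}.Countable :=
      not_countable_algebraicityLocus_of_datum hT f hf hdim (V i p)
        ⟨s i, I i, κ i, V i, 1, 0, hpI, hκ, one_ne_zero,
          fun u => by rw [map_zero]; exact Submodule.zero_mem _,
          by rw [one_smul, add_zero], hκV, hVH⟩
    exact Theorems.mem_algebraicClasses_of_thickSet charlesSchnell_algebraicityLocus_iUnion_closed_holds f hf h𝒳
      (IsQuasiProjectiveOver.of_isAffine S) ‹_› (V i p) _
      (curve_not_subset_iUnion_of_not_countable hdim _ hnc) (fun u hu => hu)
  have hWt : complexBetti.map (fiberι f t) (2 * p) W =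
      a⁻¹ • (complexBetti.map (fiberι f t) (2 * p) (∑ i, c i • V i p) -
        complexBetti.map (fiberι f t) (2 * p) Z) := by
    rw [← hsum, map_add, map_smul, add_sub_cancel_right, smul_smul, inv_mul_cancel₀ ha, one_smul]
  rw [hWt, map_sum]
  refine Submodule.smul_mem _ _ (Submodule.sub_mem _ (Submodule.sum_mem _ fun i _ => ?_) (hZ t).1)
  rw [map_smul]
  exact Submodule.smul_mem _ _ (hV i t)

/-- **Per pencil, the additive graded crux + the door ⟹ the algebraicity locus of `W` is not countable** (it is all of the
uncountable `S(ℂ)`): the twin of `not_countable_algebraicityLocus_of_lefAtDeg` the diagonal engine consumes.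
[cite: BuchweitzFlenner2003, §5 Thm. 5.1] [cite: CharlesSchnell2014Notes, Prop. 11.3.11 (proof)] -/
theorem not_countable_algebraicityLocus_of_lefAtDegAdd (hT : LocalVariationalHodgeFor 𝒪)
    (hSR : AdmissibleRepresentativesLefAtDegAdd 𝒪 n p) (f : 𝒳 ⟶ S) (hf : IsSmoothProjectiveFamily f n)
    (h𝒳 : IsQuasiProjectiveOver 𝒳) [IrreducibleSpace S.left] [IsAffine S.left] [AlgebraicGeometry.Smooth S.hom]
    (hdim : topologicalKrullDim S.left = 1)
    (habel : ∀ s : ComplexPoints S, ∃ A' : AbelianVariety ℂ, A'.dim = n ∧ Nonempty (A'.X ≅ fiberOver f s))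
    (he : ∃ e : S ⟶ 𝒳, e ≫ f = 𝟙 S) (W : complexBetti 𝒳 (2 * p))
    (hW : ∀ s : ComplexPoints S, IsRationalClass (complexBetti.map (fiberι f s) (2 * p) W) ∧
      IsOfHodgeType n (fiberOver f s) (2 * p) p p (complexBetti.map (fiberι f s) (2 * p) W))
    {s₀ : ComplexPoints S} (hs₀ : complexBetti.map (fiberι f s₀) (2 * p) W ∈ algebraicClasses (fiberOver f s₀) p) :
    ¬ {s : ComplexPoints S |
        complexBetti.map (fiberι f s) (2 * p) W ∈ algebraicClasses (fiberOver f s) p}.Countable := by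
  have huniv : {s : ComplexPoints S |
      complexBetti.map (fiberι f s) (2 * p) W ∈ algebraicClasses (fiberOver f s) p} = Set.univ :=
    Set.eq_univ_of_forall fun t =>
      map_fiberι_mem_algebraicClasses_of_lefAtDegAdd hT hSR f hf h𝒳 hdim habel he W hW hs₀ t
  rw [huniv]
  exact not_countable_of_isOpen_of_curve hdim isOpen_univ ⟨s₀, Set.mem_univ _⟩

/-! ## §3 The additive graded crux from additive regime 2 ALONE (regime 1 is datum-free) -/

/-- **K-SR♭∃ (additive) at `(n, p)` from regime 2 (additive) at `(n, p)`** — classical case split on «`W` algebraic-Lefschetz on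
every fibre»: if so, the EMPTY family with `a := 1`, `Z := −W`; if not, regime 2. No null datum and no regime-1 predicate are
needed (contrast `admissibleRepresentativesLefAtDeg_of_regimes`). [cite: vanGeemen1994HodgeAV, §2.4] -/
theorem admissibleRepresentativesLefAtDegAdd_of_regimeAdd (h₂ : LefAtExceptionalRegimeAtAdd 𝒪 n p) :
    AdmissibleRepresentativesLefAtDegAdd 𝒪 n p := by
  intro 𝒳 S f hf h𝒳 hirr haff hsm hdim habel he W hW s₀ hs₀
  by_cases hL : ∀ s : ComplexPoints S,
      complexBetti.map (fiberι f s) (2 * p) W ∈ algebraicClasses (fiberOver f s) p ∧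
      complexBetti.map (fiberι f s) (2 * p) W ∈ divisorClassesSpan (fiberOver f s) n p
  · refine ⟨0, Fin.elim0, Fin.elim0, fun i => i.elim0, Fin.elim0, Fin.elim0, 1, -W, fun i => i.elim0, one_ne_zero,
      fun t => ⟨?_, ?_⟩, ?_⟩
    · rw [map_neg]; exact Submodule.neg_mem _ (hL t).1
    · rw [map_neg]; exact Submodule.neg_mem _ (hL t).2
    · rw [one_smul, add_neg_cancel, Fin.sum_univ_zero]
  · obtain ⟨k, s, I, κ, V, c, a, Z, -, hdat, ha, hZ, hsum⟩ := h₂ f hf h𝒳 hirr haff hsm hdim habel he W hW s₀ hs₀ hL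
    exact ⟨k, s, I, κ, V, c, a, Z, hdat, ha, hZ, hsum⟩

end Summit.HodgeConjecture.HodgeConjecture.Ring2.SemiregularRepresentatives

end
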